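import Summits.QuantumFields.BalabanUV.T4Continuum.Support.NE7HintOfLandauMinSupSU2
import Summits.QuantumFields.BalabanUV.T4Continuum.Support.NE7CubeLandauMinimiserFree
import HarnessLib

/-!
# NE7 — (8)∃ FROM THE SUP LETTER OF THE FREE-BOUNDARY CUBE LANDAU MINIMISER, SU(2)∕U(2) on T⁴, `L = 2` (F305′): F305 with the RIGHT class — the trace-link minimiser over
# the bonds with BOTH endpoints in the sup-cube `Q⁺` of radius `R₀ + 1` (no coupling to the exterior links; F304′), the chart asked on the bonds based in the cube of radius
# `R₀ = (nbRad + 2ℓ + 12)·M + 2` (all inside `Q⁺`); the Landau condition holds at every site of that cube (all its neighbours lie in `Q⁺`)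

Cell `pub-balaban`, rung (B)+1 sub-cell t4, lineage `b2b-balaban-t4-ne7-p1` (CRUX PROVER NE7 #1 = OWNER of row NE7), generation 92; memo
`t4/b2b-balaban-t4-ne7-p1-g92/LOG-OBSTRUCTION.md` §4c (self-audit of F305).  Over F305 `NE7HintOfLandauMinSupSU2` (`sinhDiv_eq_zero_of_EL`, `cubeChart_of_landauEL`), F304′
`NE7CubeLandauMinimiserFree` (`exists_freeTraceLinkMinimiser`, `landau_of_isMin_free`), F301, F298.

WHY (self-audit).  F305's (MSUP) quantified over the minimisers of F304's functional, which counts the bonds straddling `∂Q` with the gauge pinned to `1` outside: that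
minimiser is coupled to the RAW exterior link variables of `U` — as rough as the gauge `U` happens to be written in (the class is gauge-invariant) — so the demanded sup
letter fails generically (the Neumann potential of an `O(1)` boundary force on `≍ R₀³` sites does not decay into the cube; the straddling bonds themselves can never all be
`≈ 1`).  F305 is a correct theorem with an unsatisfiable hypothesis.  The free-boundary minimiser (F304′: only bonds inside `Q⁺`) sees nothing but the curvature inside
`Q⁺` — the genuine lattice Uhlenbeck setting — and its Euler–Lagrange equation at every site of the inner cube of radius `R₀` is the full lattice Landau condition, which is
all `cubeChart_of_landauEL` consumes.  (MSUP′) below is therefore the interface ROAD (U)∕(U′) (B2) must supply: the sup letter `‖log U^{u}‖ ≤ c₀t∕M` on the bonds based in the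
cube of radius `R₀`, for the free minimiser on `Q⁺`.
WHAT ([folklore] composition; 0 def, 0 sorry).  **`hint_of_freeLandauMinSup_SU2`**: ∀ `A ≥ 0`, `p` ∃ `ℓ ≥ 1`, `ε₀ > 0` ∀ `0 < ε ≤ ε₀` ∃ `β₀ > 0` ∀ `0 < β ≤ β₀` ∀ `N ≥ 1` ∀ `c₀ ∈
[0, A(ℓ+1)^p]`: route Π's two lines ∧ (MSUP′ on the `(4ℓ+64)`-fold cover) ∧ hleaves ⟹ (8)∃.
HONEST FRAMING (page 1): (MSUP′) is a HYPOTHESIS (the target of ROAD (U) (B2)), asserted for nothing; hleaves ([B11] Prop 2 TYPE) likewise; nothing of Bałaban's asserted as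
an axiom; NE7 NOT PROVED unconditionally; spine 0∕9; finite T⁴ rung (B)+1 — NOT infinite volume, NOT mass gap, NOT `BetaPertH`, NOT Clay.  Continuum YM on T⁴ ⇐ BetaPertH
∧ nine spine estimates (0/9 proved); BetaPertH ⇐ (D1) ∧ (D4) ∧ CAP+tail; G-an2-4 gates asym, D1 and NE2/3/4.  No `sorry`; axioms ⊆ {propext, Classical.choice, Quot.sound}.
-/

set_option autoImplicit false

open scoped BigOperators Matrix Matrix.Norms.L2Operator Topology
open NormedSpace Finset Set Filter

namespace Summit.QuantumFields.BalabanUV.T4Continuum.NE7HintOfFreeLandauMinSupSU2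

open Literature.MathematicalPhysics.QuantumFieldTheory.Balaban1983to89
open B7Prop1Explicit B7Prop2Explicit MatrixLog UnitaryModel MatrixNorms
open B4TorusKernel.MultiPeriod (torusSupNorm)
open B8Ineq132 (covDiv)
open T4AveragingDeficitWall (Ad IsUnitaryCfg IsSkewDir SmallField vary curl curlSq dirSq dirL1)
open T4AveragingDeficitWallBoundary (IsPeriodicCfg periodBox)
open AveragingDeficitPeriodicCounting (IsPeriodicDir)
open AveragingDeficitMultiLevelPrep (LevelSmall tower TangentIter)
open BlockAverageVaryHolo (nbRad)
open MinimalActionLevels (perWin)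
open MinimalActionSandwich (IsMinimiser admissible)
open MinimalActionRate (sfClass)
open NE3HessForm (dAction)
open NE3SlicePoincareBudgetLine (CPLine)
open NE3TangentCovariantTower (dirIter)
open NE3DecomposedRepOfLinearNormalPart (ResidualSliceRepT)
open NE3QbarIterCovLiftPrep (cruxC)
open NE3SmoothRightInverseW (rightInvW)
open NE3RightInverseSolveLetters (thetaLoc)
open NE3RightInverseL2Letter (l2C)
open NE3HatInvCurlLetters (curl2C curl1C)
open NE3EnergyShapes (IsUnitarySite)
open BlockAveragePushDirSplit (flat)
open NE7HintOfCubeChartSU2 (hint_of_cubeChart_SU2)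
open NE7ClassCurrentBound (exists_classCurrentConst)
open NE7HintOfLandauSupChartSU2 (gradLetter_arith)
open NE7CubeGradientLandauEL (norm_fdiff_le_of_landauEL_cube)
open NE7CubeLandauMinimiserFree (exists_freeTraceLinkMinimiser landau_of_isMin_free)
open NE7HintOfLandauMinSupSU2 (sinhDiv_eq_zero_of_EL cubeChart_of_landauEL)
open NE7LocalGradientBootstrap (mem_cube_iff)
open Literature.NumberTheory.Sieve.SquarefreeSums (exp_sub_one_le_two_mul)

noncomputable section

variable {n : Type*} [Fintype n] [DecidableEq n]

/-! ## (8)∃ from the sup letter of the free-boundary cube Landau minimiser -/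

set_option maxHeartbeats 1600000 in
/-- **F305′ — (8)∃ FROM THE SUP LETTER OF THE FREE-BOUNDARY CUBE LANDAU MINIMISER, SU(2)∕U(2) on T⁴, `L = 2`.**  [Balaban1985Variational] Thm 1 (8) ∘ Prop 8 ∘ a one-scale lattice
Uhlenbeck sup letter TYPE, rows NE7 ∘ NE3, `card n = 2`: for all `A ≥ 0` and `p` there are `ℓ ≥ 1`, `ε₀ > 0` and, for every `0 < ε ≤ ε₀`, a `β₀ > 0` such that for `0 < β ≤ β₀`,
every period `N ≥ 1` and all `c₀ ∈ [0, A(ℓ+1)^p]`: IF route Π's two `k`-free lines, (MSUP) — for every tangent-critical admissible configuration on the `(4ℓ+64)`-fold cover with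
small field `r ≤ ε∕4`, every centre `z` and every unitary site gauge `u`, `= 1` off the sup-cube `Q⁺_z` of radius `R₀ + 1`, `R₀ = (nbRad 4 2 + 2ℓ + 12)·2^{k+1} + 2`, minimising the
trace-link functional over the bonds with BOTH endpoints in `Q⁺_z` among such gauges (free boundary): `U^{u} = e^{A}` with `A` skew and `‖A‖ ≤ c₀t∕M` on the bonds based in
the cube of radius `R₀` — and row NE3's `hleaves` hold, THEN for some `δ_V > 0`, over `{V | unitary, N-periodic, SmallField V δ_V}`, at every level some constrained minimiser over `sfClass 4 2 N ε` is `SmallField U a`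
with `0 ≤ a < ε∕(2^k)²`.  The minimising gauge EXISTS and is Landau on the inner cube (F304′); its gradient letter follows (F303, F301); NE7 is NOT proved unconditionally ((MSUP), `hleaves`, the
two lines remain). -/
theorem hint_of_freeLandauMinSup_SU2 [Nonempty n] (hn : Fintype.card n = 2) {A : ℝ} (hA : 0 ≤ A) (p : ℕ) :
    ∃ ℓ : ℕ, 1 ≤ ℓ ∧ ∃ ε₀ : ℝ, 0 < ε₀ ∧ ∀ ε : ℝ, 0 < ε → ε ≤ ε₀ → ∃ β₀ : ℝ, 0 < β₀ ∧ ∀ β : ℝ, 0 < β → β ≤ β₀ →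
    ∀ (N : ℕ) [NeZero N] (C₂ αh Ch νh κh c₀ : ℝ), 1 ≤ N →
    0 ≤ C₂ → 0 ≤ αh → αh ≤ 1 → 0 ≤ Ch →
    νh = 2 * Real.sqrt (l2C 4 2 / (1 - thetaLoc 4 2 * ε) ^ 2 + curl2C 4 2 / (1 - thetaLoc 4 2 * ε) ^ 2) * C₂ * Ch * αh →
    κh = 4 * (curl1C 4 2 / (1 - thetaLoc 4 2 * ε)) * C₂ * Ch ^ 2 * ε →
    νh < 1 →
    2 * (κh / (1 - νh) ^ 2) < ((((1 / 2 - (νh / (1 - νh)) ^ 2) / (2 * (1 + (CPLine 4 2 2 (1 / 10 ^ 17) (1 / 10 ^ 53) + 1))) - (νh / (1 - νh)) ^ 2) / 2 - 576 * ((4 : ℕ) : ℝ) * (αh ^ 2 * Real.exp (2 * αh))) / (Fintype.card n : ℝ) - 28 * ((4 : ℕ) : ℝ) * (ε + 7 * αh ^ 2)) →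
    0 ≤ c₀ → c₀ ≤ A * ((ℓ : ℝ) + 1) ^ p →
    -- (MSUP′): the sup letter of the free-boundary cube Landau minimiser, on the `(4ℓ+64)`-fold cover
    (∀ D : Site 4 → Fin 4 → (Matrix n n ℂ)ˣ, IsUnitaryCfg D → IsPeriodicCfg D ((N * (4 * ℓ + 64)) : ℤ) → SmallField D (4 * (Real.exp β - 1)) →
      ∀ (k : ℕ), ∀ U ∈ admissible (sfClass 4 2 (N * (4 * ℓ + 64)) ε) 2 (k + 1) D,
      (∀ φ : Site 4 → Fin 4 → Matrix n n ℂ, IsSkewDir φ → IsPeriodicDir φ (((N * (4 * ℓ + 64)) * 2 ^ (k + 1) : ℕ) : ℤ) → TangentIter 2 k U φ →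
        dAction U φ (perWin 4 ((N * (4 * ℓ + 64)) * 2 ^ (k + 1))) = 0) →
      ∀ r : ℝ, 0 ≤ r → r ≤ (1 / ((2 : ℕ) : ℝ) ^ 2 * ε) → SmallField U (r / (((2 : ℕ) : ℝ) ^ (k + 1)) ^ 2) →
      ∀ (z : Site 4) (u : Site 4 → (Matrix n n ℂ)ˣ), (∀ x, u x ∈ unitaryUnits (Matrix n n ℂ)) →
        (∀ x, x ∉ Finset.Icc (z - fun _ => (((nbRad 4 2 + 2 * ℓ + 12) * 2 ^ (k + 1) + 2 + 1 : ℕ) : ℤ)) (z + fun _ => (((nbRad 4 2 + 2 * ℓ + 12) * 2 ^ (k + 1) + 2 + 1 : ℕ) : ℤ)) → u x = 1) →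
        (∀ v : Site 4 → (Matrix n n ℂ)ˣ, (∀ x, v x ∈ unitaryUnits (Matrix n n ℂ)) →
          (∀ x, x ∉ Finset.Icc (z - fun _ => (((nbRad 4 2 + 2 * ℓ + 12) * 2 ^ (k + 1) + 2 + 1 : ℕ) : ℤ)) (z + fun _ => (((nbRad 4 2 + 2 * ℓ + 12) * 2 ^ (k + 1) + 2 + 1 : ℕ) : ℤ)) → v x = 1) →
          ∑ x ∈ Finset.Icc (z - fun _ => (((nbRad 4 2 + 2 * ℓ + 12) * 2 ^ (k + 1) + 2 + 1 : ℕ) : ℤ)) (z + fun _ => (((nbRad 4 2 + 2 * ℓ + 12) * 2 ^ (k + 1) + 2 + 1 : ℕ) : ℤ)), ∑ κ : Fin 4,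
              (if x + e κ ∈ Finset.Icc (z - fun _ => (((nbRad 4 2 + 2 * ℓ + 12) * 2 ^ (k + 1) + 2 + 1 : ℕ) : ℤ)) (z + fun _ => (((nbRad 4 2 + 2 * ℓ + 12) * 2 ^ (k + 1) + 2 + 1 : ℕ) : ℤ)) then (1 - nReTr ((gaugeAct u U x κ : (Matrix n n ℂ)ˣ) : Matrix n n ℂ)) else 0)
            ≤ ∑ x ∈ Finset.Icc (z - fun _ => (((nbRad 4 2 + 2 * ℓ + 12) * 2 ^ (k + 1) + 2 + 1 : ℕ) : ℤ)) (z + fun _ => (((nbRad 4 2 + 2 * ℓ + 12) * 2 ^ (k + 1) + 2 + 1 : ℕ) : ℤ)), ∑ κ : Fin 4,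
                (if x + e κ ∈ Finset.Icc (z - fun _ => (((nbRad 4 2 + 2 * ℓ + 12) * 2 ^ (k + 1) + 2 + 1 : ℕ) : ℤ)) (z + fun _ => (((nbRad 4 2 + 2 * ℓ + 12) * 2 ^ (k + 1) + 2 + 1 : ℕ) : ℤ)) then (1 - nReTr ((gaugeAct v U x κ : (Matrix n n ℂ)ˣ) : Matrix n n ℂ)) else 0)) →
        ∃ A : Site 4 → Fin 4 → Matrix n n ℂ,
          (∀ (p : Site 4) (μ : Fin 4), (∀ i, |p i - z i| ≤ (((nbRad 4 2 + 2 * ℓ + 12) * 2 ^ (k + 1) + 2 : ℕ) : ℤ)) → A p μ ∈ skewAdjoint (Matrix n n ℂ)) ∧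
          (∀ (p : Site 4) (μ : Fin 4), (∀ i, |p i - z i| ≤ (((nbRad 4 2 + 2 * ℓ + 12) * 2 ^ (k + 1) + 2 : ℕ) : ℤ)) → gaugeAct u U p μ = expUnit (A p μ)) ∧
          (∀ (p : Site 4) (μ : Fin 4), (∀ i, |p i - z i| ≤ (((nbRad 4 2 + 2 * ℓ + 12) * 2 ^ (k + 1) + 2 : ℕ) : ℤ)) →
            ‖A p μ‖ ≤ c₀ * (r + 4 * (Real.exp β - 1) + ε) / ((2 : ℕ) : ℝ) ^ (k + 1))) →
    -- ROW NE3's PER-PAIR BINDER on the data class (F31's `hleaves`)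
    (∀ D : Site 4 → Fin 4 → (Matrix n n ℂ)ˣ, IsUnitaryCfg D → IsPeriodicCfg D (N : ℤ) → SmallField D (4 * (Real.exp β - 1)) → ∀ (k : ℕ), ∀ Us ∈ admissible (sfClass 4 2 N ε) 2 (k + 1) D, SmallField Us ((1 / ((2 : ℕ) : ℝ) ^ 2 * ε / 2) / (((2 : ℕ) : ℝ) ^ (k + 1)) ^ 2) → (∀ φ : Site 4 → Fin 4 → Matrix n n ℂ, IsSkewDir φ → IsPeriodicDir φ ((N * 2 ^ (k + 1) : ℕ) : ℤ) → TangentIter 2 k Us φ → dAction Us φ (perWin 4 (N * 2 ^ (k + 1))) = 0) → ∀ U' ∈ admissible (sfClass 4 2 N ε) 2 (k + 1) D, ∃ (u : Site 4 → (Matrix n n ℂ)ˣ) (X₀ : Site 4 → Fin 4 → Matrix n n ℂ) (α₀ : ℝ) (m : Site 4 → Fin 4 → ℝ) (C : ℝ), IsSkewDir X₀ ∧ (∀ (hWu : IsUnitaryCfg Us) (hx : 0 ≤ ε / (((2 : ℕ) : ℝ) ^ (k + 1)) ^ 2) (hs : LevelSmall 4 2 k (ε / (((2 : ℕ) : ℝ)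 ^ (k + 1)) ^ 2)) (hWx : SmallField Us (ε / (((2 : ℕ) : ℝ) ^ (k + 1)) ^ 2)) (hθ : cruxC 4 2 * ((((2 : ℕ) : ℝ) ^ (k + 1)) ^ 2 * (ε / (((2 : ℕ) : ℝ) ^ (k + 1)) ^ 2)) < 1) (hφ : IsSkewDir (dirIter 2 (k + 1) Us X₀)), ResidualSliceRepT 2 N (k + 1) Us U' u X₀ (rightInvW (by norm_num) k hWu hx hs hWx N hθ hφ) α₀) ∧ (∀ z κ, 0 ≤ m z κ) ∧ 0 ≤ C ∧ (((2 : ℕ) : ℝ) ^ (k + 1)) ^ 4 * ∑ z ∈ periodBox (d := 4) N, ∑ κ : Fin 4, m z κ ^ 2 ≤ C ^ 2 * dirSq X₀ (periodBox (d := 4) (N * 2 ^ (k + 1))) ∧ (∀ z ∈ periodBox (d := 4) N, ∀ κ : Fin 4, ‖dirIter 2 (k + 1) Us X₀ z κ‖ ≤ C₂ * (((2 : ℕ) : ℝ) ^ (k + 1) * m z κ) ^ 2) ∧ α₀ * ((2 : ℕ) : ℝ) ^ (k + 1) ≤ αh ∧ (∀ z κ, m z κ * ((2 : ℕ) : ℝ)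 ^ (k + 1) ≤ αh) ∧ C ≤ Ch) →
    ∃ δV : ℝ, 0 < δV ∧
      ∀ V ∈ {V : Site 4 → Fin 4 → (Matrix n n ℂ)ˣ | IsUnitaryCfg V ∧ IsPeriodicCfg V (N : ℤ) ∧ SmallField V δV},
      ∀ k : ℕ, ∃ U : Site 4 → Fin 4 → (Matrix n n ℂ)ˣ, IsMinimiser 4 (sfClass 4 2 N ε) 2 N k V U ∧
        ∃ a : ℝ, 0 ≤ a ∧ a < ε / (((2 : ℕ) : ℝ) ^ k) ^ 2 ∧ SmallField U a := by
  obtain ⟨C, hC0, hC⟩ := exists_classCurrentConst (n := n)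
  set A' : ℝ := 62 * A + 1024 * (2 * C + 48) + 34816 * A with hA'
  have hA'0 : 0 ≤ A' := by positivity
  obtain ⟨ℓ, hℓ1, ε₀, hε₀, H⟩ := hint_of_cubeChart_SU2 (n := n) hn (A := A') hA'0 (p + 2)
  have hℓ0 : (0 : ℝ) ≤ (ℓ : ℝ) := Nat.cast_nonneg ℓ
  set T : ℝ := 1 / (1152 * (2 * (ℓ : ℝ) + 32) * (A * ((ℓ : ℝ) + 1) ^ p + 1)) with hT
  have hT0 : 0 < T := by positivity
  refine ⟨ℓ, hℓ1, min ε₀ (min (1 / 10 ^ 53) (T / 3)), lt_min hε₀ (lt_min (by norm_num) (by positivity)), fun ε hε hεle => ?_⟩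
  obtain ⟨β₀, hβ₀, H2⟩ := H ε hε (hεle.trans (min_le_left _ _))
  refine ⟨min β₀ (min 1 (T / 24)), lt_min hβ₀ (lt_min one_pos (by positivity)), ?_⟩
  intro β hβ hβle N _ C₂ αh Ch νh κh c₀ hN hC₂ hαh0 hαh1 hCh0 hνh hκh hν hline hc₀ hc₀b hMSUP hleaves
  have hε53 : ε ≤ 1 / 10 ^ 53 := hεle.trans ((min_le_right _ _).trans (min_le_left _ _))
  have hεT : ε ≤ T / 3 := hεle.trans ((min_le_right _ _).trans (min_le_right _ _))
  have hβ1 : β ≤ 1 := hβle.trans ((min_le_right _ _).trans (min_le_left _ _))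
  have hβT : β ≤ T / 24 := hβle.trans ((min_le_right _ _).trans (min_le_right _ _))
  have hexpβ : 4 * (Real.exp β - 1) ≤ T / 3 := by
    have h := exp_sub_one_le_two_mul hβ.le hβ1; linarith
  -- the derived gradient constant and its polynomial bound
  set c₁ : ℝ := 62 * c₀ + (2 * (ℓ : ℝ) + 32) ^ 2 * (2 * C + 32 * c₀ + 48 + 2 * 0) with hc₁
  have hc₁0 : 0 ≤ c₁ := by positivity
  have hpow2 : ((ℓ : ℝ) + 1) ^ p ≤ ((ℓ : ℝ) + 1) ^ (p + 2) := pow_le_pow_right₀ (by linarith) (by omega)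
  have hsq : (2 * (ℓ : ℝ) + 32) ^ 2 ≤ 1024 * ((ℓ : ℝ) + 1) ^ 2 := by nlinarith
  have hpow_eq : ((ℓ : ℝ) + 1) ^ (p + 2) = ((ℓ : ℝ) + 1) ^ 2 * ((ℓ : ℝ) + 1) ^ p := by ring
  have hQ : 0 ≤ A * ((ℓ : ℝ) + 1) ^ p := by positivity
  have hc₁b : c₁ ≤ A' * ((ℓ : ℝ) + 1) ^ (p + 2) := by
    have h1 : 2 * C + 32 * c₀ + 48 + 2 * 0 ≤ 2 * C + 48 + 34 * (A * ((ℓ : ℝ) + 1) ^ p) := by linarith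
    have h2 : (2 * (ℓ : ℝ) + 32) ^ 2 * (2 * C + 32 * c₀ + 48 + 2 * 0) ≤ (1024 * ((ℓ : ℝ) + 1) ^ 2) * (2 * C + 48 + 34 * (A * ((ℓ : ℝ) + 1) ^ p)) :=
      mul_le_mul hsq h1 (by positivity) (by positivity)
    have h3 : 62 * c₀ ≤ 62 * A * ((ℓ : ℝ) + 1) ^ (p + 2) := by nlinarith
    have h4 : (1024 * ((ℓ : ℝ) + 1) ^ 2) * (2 * C + 48 + 34 * (A * ((ℓ : ℝ) + 1) ^ p))
        = 1024 * (2 * C + 48) * ((ℓ : ℝ) + 1) ^ 2 + 34816 * A * ((ℓ : ℝ) + 1) ^ (p + 2) := by rw [hpow_eq]; ring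
    have h5 : 1024 * (2 * C + 48) * ((ℓ : ℝ) + 1) ^ 2 ≤ 1024 * (2 * C + 48) * ((ℓ : ℝ) + 1) ^ (p + 2) := by
      have : ((ℓ : ℝ) + 1) ^ 2 ≤ ((ℓ : ℝ) + 1) ^ (p + 2) := pow_le_pow_right₀ (by linarith) (by omega)
      exact mul_le_mul_of_nonneg_left this (by positivity)
    rw [hc₁, hA']; nlinarith
  have hc₀b' : c₀ ≤ A' * ((ℓ : ℝ) + 1) ^ (p + 2) := by
    have h1 : A * ((ℓ : ℝ) + 1) ^ p ≤ A * ((ℓ : ℝ) + 1) ^ (p + 2) := mul_le_mul_of_nonneg_left hpow2 hA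
    have h2 : A * ((ℓ : ℝ) + 1) ^ (p + 2) ≤ A' * ((ℓ : ℝ) + 1) ^ (p + 2) := by
      apply mul_le_mul_of_nonneg_right _ (by positivity); rw [hA']; nlinarith
    linarith
  refine H2 β hβ (hβle.trans (min_le_left _ _)) N C₂ αh Ch νh κh c₀ c₁ hN hC₂ hαh0 hαh1 hCh0 hνh hκh hν hline hc₀ hc₀b' hc₁0 hc₁b ?_ hleaves
  -- (CUBE) from (MSUP′): the free minimiser on `Q⁺` exists (F304′), is Landau at every site of the inner cube, and (MSUP′) gives its log chart
  intro D hDu hDP hDs k U hU hcrit r hr0 hr hUr z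
  haveI : NeZero (N * (4 * ℓ + 64)) := ⟨mul_ne_zero (NeZero.ne N) (by omega)⟩
  have hr4 : r ≤ ε / 4 := by have e := hr; norm_num at e; linarith
  have hr14 : r ≤ 1 / 4 := by linarith [hε53.trans (by norm_num : (1 : ℝ) / 10 ^ 53 ≤ 1)]
  have hcur := hC (N * (4 * ℓ + 64)) ε hε hε53 D k U hU hcrit r hr0 hr14 hUr
  -- the cube `Q` of radius `R₀` and the base set `B` of radius `R₀ + 1`
  obtain ⟨u, hu, huQ, hmin⟩ := exists_freeTraceLinkMinimiser
    (Finset.Icc (z - fun _ => (((nbRad 4 2 + 2 * ℓ + 12) * 2 ^ (k + 1) + 2 + 1 : ℕ) : ℤ)) (z + fun _ => (((nbRad 4 2 + 2 * ℓ + 12) * 2 ^ (k + 1) + 2 + 1 : ℕ) : ℤ))) U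
  obtain ⟨A₀, hskew, hUA, hA0⟩ := hMSUP D hDu hDP hDs k U hU hcrit r hr0 hr hUr z u hu huQ hmin
  -- Euler–Lagrange at every site of `Q`
  have hEL : ∀ (y : Site 4), (∀ i, |y i - z i| ≤ (((nbRad 4 2 + 2 * ℓ + 12) * 2 ^ (k + 1) + 2 : ℕ) : ℤ)) →
      ∑ κ : Fin 4, ((((gaugeAct u U y κ : (Matrix n n ℂ)ˣ) : Matrix n n ℂ) - ((gaugeAct u U y κ : (Matrix n n ℂ)ˣ) : Matrix n n ℂ)ᴴ)
        - (((gaugeAct u U (y - e κ) κ : (Matrix n n ℂ)ˣ) : Matrix n n ℂ) - ((gaugeAct u U (y - e κ) κ : (Matrix n n ℂ)ˣ) : Matrix n n ℂ)ᴴ)) = 0 := by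
    intro y hy
    have e1 : ∀ (a : Fin 4) (i : Fin 4), |(e a : Site 4) i| ≤ 1 := fun a i => by rw [e_apply]; split_ifs <;> simp
    refine landau_of_isMin_free _ hu huQ hmin ((mem_cube_iff z _ y).mpr fun i => (hy i).trans (by push_cast; linarith)) ?_ ?_
    · intro κ
      refine (mem_cube_iff z _ _).mpr fun i => ?_
      have : |(y + e κ) i - z i| ≤ |(e κ : Site 4) i| + |y i - z i| := by
        rw [show (y + e κ) i - z i = (e κ : Site 4) i + (y i - z i) by simp; ring]
        exact abs_add_le _ _
      have hyi := hy i
      push_cast at hyi ⊢; linarith [e1 κ i, hyi]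
    · intro κ
      refine (mem_cube_iff z _ _).mpr fun i => ?_
      have : |(y - e κ) i - z i| ≤ |(e κ : Site 4) i| + |y i - z i| := by
        rw [show (y - e κ) i - z i = -(e κ : Site 4) i + (y i - z i) by simp; ring]
        exact (abs_add_le _ _).trans (by rw [abs_neg])
      have hyi := hy i
      push_cast at hyi ⊢; linarith [e1 κ i, hyi]
  -- the regime
  have ht : r + 4 * (Real.exp β - 1) + ε ≤ 1 / (1152 * (2 * (ℓ : ℝ) + 32) * (c₀ + 1)) := by
    have h1 : r + 4 * (Real.exp β - 1) + ε ≤ T := by linarith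
    have h2 : T ≤ 1 / (1152 * (2 * (ℓ : ℝ) + 32) * (c₀ + 1)) := by
      rw [hT]; apply div_le_div_of_nonneg_left (by norm_num) (by positivity)
      exact mul_le_mul_of_nonneg_left (by linarith) (by positivity)
    linarith
  -- radii
  have hsub : ∀ (q : Site 4), (∀ i, |q i - z i| ≤ (((nbRad 4 2 + 2 * ℓ + 11) * 2 ^ (k + 1) : ℕ) : ℤ)) →
      ∀ i, |q i - z i| ≤ (((nbRad 4 2 + 2 * ℓ + 12) * 2 ^ (k + 1) + 2 : ℕ) : ℤ) := fun q hq i =>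
    (hq i).trans (by push_cast; nlinarith [show (1 : ℤ) ≤ 2 ^ (k + 1) by exact_mod_cast Nat.one_le_two_pow])
  refine ⟨u, A₀, hu, fun q μ hq => hUA q μ (hsub q hq), fun q μ hq => hskew q μ (hsub q hq), fun q μ hq => hA0 q μ (hsub q hq), fun q μ τ hq _ => ?_⟩
  exact cubeChart_of_landauEL (n := n) ℓ k hr0 hε.le hβ.le hc₀ hC0 ht hUr hcur hu z hUA hskew hA0 hEL q μ τ hq

end

end Summit.QuantumFields.BalabanUV.T4Continuum.NE7HintOfFreeLandauMinSupSU2
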